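import Literature.NumberTheory.EllipticCurves.CanonicalPAdicHeightCycGaloisProofs
import Literature.NumberTheory.EllipticCurves.PadicSigmaSqThetaNormedAlgebraProofs
import Literature.NumberTheory.EllipticCurves.CanonicalPAdicHeightCycSigmaNormLogProofs
import Literature.NumberTheory.NumberFields.PrimesAbovePEmbeddingNormProofs
import HarnessLib

/-!
# The parallelogram law of the cyclotomic `p`-adic height formula over a number field `H`, any prime
# `p`, read at the embeddings `H → ℂ_p` (proofs only)

Topic `Literature/NumberTheory/EllipticCurves` (trunk T-NT-EC); PROOFS file (theorems only). Second
file of the programme proving the named fact `WeierstrassCurve.exists_isCanonicalCyc`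
(`CanonicalPAdicHeightCyc.lean`) at EVERY prime `p`: the `p`-generic form of
`canonicalPAdicHeightCyc_parallelogram_two` (`CanonicalPAdicHeightCycExistenceTwoProofs.lean`, `p = 2`),
with the place-wise hypothesis «`1 < w(4x)` at every `w ∋ 2`» of that file replaced by its
embedding-wise consequence «`‖σ x‖ > 1` under every `σ : H → ℂ_p`», which is all the proof uses and is
how the any-`p` locus subgroup of `CanonicalPAdicHeightCycLocusProofs.lean` describes its members.

For `W/ℚ` elliptic with integer coefficients, a sigma-squared pair of `W ⊗ ℚ_p`
(`IsMazurTateSigmaSqPair`) and affine `P, Q ∈ E(H)` with `P ± Q` affine, all four points having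
`‖σ x‖ > 1` at every embedding and `P, Q` non-singular reduction everywhere:
`ĥ(P+Q) + ĥ(P−Q) = 2ĥ(P) + 2ĥ(Q)` for `ĥ = canonicalPAdicHeightCyc W p H`. Denominators: Néron's local
laws summed over the places of `H` (`absNorm_denominatorIdeal_parallelogram`:
`N𝔡₃N𝔡₄ = N𝔡₁²N𝔡₂²N(x₁−x₂)²`); `p`-part: after `ι : ℚ_p → ℂ_p`, `ι(S zᵢ) = Σ_σ Log Σ_p(σzᵢ)`
(`algebraMap_sigmaSqNormLog_eq_sum_embeddings`) and the squared theta relation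
`Σ_p(σz₃)Σ_p(σz₄) = (σx₂−σx₁)²Σ_p(σz₁)²Σ_p(σz₂)²` at every embedding
(`padicAlgEval_padicSigmaSq_theta_ringHom`), the terms `2 log_p N(x₁−x₂)` cancelling
(Mazur–Stein–Tate 2006 §2.6–2.8 on `Σ = σ²`). BSD is not proved by any of this.

## References

* B. Mazur, W. Stein, J. Tate, Doc. Math. Extra Vol. Coates (2006), §2.6–2.8. [MazurSteinTate2006]
* B. Mazur, J. Tate, Duke Math. J. 62 (1991), Thm. 3.1 (property IV of `σ`). [MazurTate1991]
* J. H. Silverman, Math. Ann. 332 (2005), §5 Rem. 2 (`σ²` at `p = 2`). [Silverman2005DivPoly]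
-/

noncomputable section

open scoped Classical
open IsDedekindDomain NumberField WeierstrassCurve
open Literature.NumberTheory.NumberFields Literature.NumberTheory.Transcendental
  Literature.NumberTheory.LocalFields

namespace Literature.NumberTheory.EllipticCurves

variable (W : WeierstrassCurve ℚ) [W.IsElliptic] [W.IsIntegral ℤ] (p : ℕ) [Fact p.Prime]
  (H : Type) [Field H] [NumberField H]

omit [W.IsElliptic] [W.IsIntegral ℤ] in
/-- `(W ⊗ ℚ_p) ⊗ ℂ_p = W ⊗ ℂ_p`. [folklore] -/
private theorem baseChange_padic_baseChange :
    (W.baseChange ℚ_[p]).baseChange ℂ_[p] = W.baseChange ℂ_[p] := by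
  rw [baseChange, baseChange, baseChange, map_map]
  congr 1
  exact Subsingleton.elim _ _

variable {W p H} in
omit [W.IsElliptic] in
/-- **Embedding-side facts for a point of `E₁` at `σ`**: if `(x, y) ∈ E(H)` has `‖σ x‖ > 1` for an
embedding `σ : H → ℂ_p`, then `σ y ≠ 0`, `z = −x/y ≠ 0`, `σ z = −σx/σy`, `‖σ z‖ < 1`, `σ z ≠ 0`
(`param_facts_alg` on the `p`-integral `W ⊗ ℚ_p`). [cite: SilvermanAEC2009, VII.2.2] -/
theorem emb_facts_of_one_lt_norm {x y : H} (h : (W.baseChange H).toAffine.Nonsingular x y)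
    (σ : H →ₐ[ℚ] ℂ_[p]) (hx : 1 < ‖σ x‖) :
    -x / y ≠ 0 ∧ σ (-x / y) = -σ x / σ y ∧ ‖σ (-x / y)‖ < 1 ∧ σ (-x / y) ≠ 0 := by
  have hh : (W.baseChange ℂ_[p]).toAffine.Nonsingular (σ x) (σ y) :=
    (Affine.baseChange_nonsingular (W := W.toAffine) (f := σ) σ.toRingHom.injective x y).mpr h
  have heq : ((W.baseChange ℚ_[p]).baseChange ℂ_[p]).toAffine.Equation (σ x) (σ y) :=
    ((baseChange_padic_baseChange W p).symm ▸ hh).1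
  obtain ⟨hy0, hz0, hz1, -, -⟩ := (W.baseChange ℚ_[p]).param_facts_alg heq hx
  have hσz : σ (-x / y) = -σ x / σ y := by rw [map_div₀, map_neg]
  have hx0 : x ≠ 0 := fun h0 => by rw [h0, map_zero, norm_zero] at hx; exact not_lt.mpr zero_le_one hx
  have hy : y ≠ 0 := fun h0 => by rw [h0, map_zero] at hy0; exact hy0 rfl
  exact ⟨div_ne_zero (neg_ne_zero.mpr hx0) hy, hσz, by rwa [hσz], by rwa [hσz]⟩

variable {W p H} in
/-- **The height formula satisfies the parallelogram law on generic pairs of the `p`-adic locus**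
(any prime `p`, any number field `H`, sigma-squared pair of `W ⊗ ℚ_p` given): for affine
`P = (x₁, y₁)`, `Q = (x₂, y₂) ∈ E(H)` with `P ± Q = (x₃, y₃), (x₄, y₄)`, all four having `‖σ x‖ > 1`
under every embedding `σ : H → ℂ_p`, and `P, Q` with non-singular reduction everywhere:
`ĥ(P+Q) + ĥ(P−Q) = 2ĥ(P) + 2ĥ(Q)` for `ĥ = canonicalPAdicHeightCyc W p H`. Denominators: Néron's laws
summed over the places of `H` (`N𝔡₃N𝔡₄ = N𝔡₁²N𝔡₂²N(x₁−x₂)²`); `p`-part: after `ι : ℚ_p → ℂ_p`,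
`ι(S zᵢ) = Σ_σ Log Σ_p(σzᵢ)` and the squared theta relation
`Σ_p(σz₃)Σ_p(σz₄) = (σx₂−σx₁)²Σ_p(σz₁)²Σ_p(σz₂)²` at every embedding, so that the terms
`2 log_p N(x₁−x₂)` cancel. [cite: MazurSteinTate2006, §2.8 (PDF p. 11 L33–58)]
[cite: MazurTate1991, Thm. 3.1] -/
theorem canonicalPAdicHeightCyc_parallelogram
    (hpair : ∃ Sq : PowerSeries ℚ_[p], ∃ c : ℚ_[p], (W.baseChange ℚ_[p]).IsMazurTateSigmaSqPair Sq c)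
    {x₁ y₁ x₂ y₂ x₃ y₃ x₄ y₄ : H}
    (h₁ : (W.baseChange H).toAffine.Nonsingular x₁ y₁) (h₂ : (W.baseChange H).toAffine.Nonsingular x₂ y₂)
    (h₃ : (W.baseChange H).toAffine.Nonsingular x₃ y₃) (h₄ : (W.baseChange H).toAffine.Nonsingular x₄ y₄)
    (hS : (.some x₁ y₁ h₁ : (W.baseChange H).toAffine.Point) + .some x₂ y₂ h₂ = .some x₃ y₃ h₃)
    (hD : (.some x₁ y₁ h₁ : (W.baseChange H).toAffine.Point) - .some x₂ y₂ h₂ = .some x₄ y₄ h₄)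
    (hx : x₁ ≠ x₂)
    (hσ₁ : ∀ σ : H →ₐ[ℚ] ℂ_[p], 1 < ‖σ x₁‖) (hσ₂ : ∀ σ : H →ₐ[ℚ] ℂ_[p], 1 < ‖σ x₂‖)
    (hσ₃ : ∀ σ : H →ₐ[ℚ] ℂ_[p], 1 < ‖σ x₃‖) (hσ₄ : ∀ σ : H →ₐ[ℚ] ℂ_[p], 1 < ‖σ x₄‖)
    (hns₁ : ∀ v : HeightOneSpectrum (𝓞 H), W.HasNonsingularReductionAtK H v x₁ y₁)
    (hns₂ : ∀ v : HeightOneSpectrum (𝓞 H), W.HasNonsingularReductionAtK H v x₂ y₂) :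
    W.canonicalPAdicHeightCyc p H (.some x₃ y₃ h₃) + W.canonicalPAdicHeightCyc p H (.some x₄ y₄ h₄) =
      2 * W.canonicalPAdicHeightCyc p H (.some x₁ y₁ h₁) +
        2 * W.canonicalPAdicHeightCyc p H (.some x₂ y₂ h₂) := by
  have hmulp : padicLog_mul p := padicLog_mul_holds p
  -- the denominator identity and its logarithm (verbatim as over `K`)
  have hden := absNorm_denominatorIdeal_parallelogram h₁ h₂ h₃ h₄ hx hS hD fun v => ⟨hns₁ v, hns₂ v⟩
  have hN0 : ∀ x : H, ((Ideal.absNorm (WeierstrassCurve.denominatorIdeal H x) : ℚ) : ℚ_[p]) ≠ 0 :=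
    fun x => by
    exact_mod_cast Ideal.absNorm_eq_zero_iff.not.mpr (denominatorIdeal_ne_bot H x)
  have hδ : ((Algebra.norm ℚ (x₁ - x₂) : ℚ) : ℚ_[p]) ≠ 0 := by
    exact_mod_cast Algebra.norm_ne_zero_iff.mpr (sub_ne_zero.mpr hx)
  have hdenp : ((Ideal.absNorm (WeierstrassCurve.denominatorIdeal H x₃) : ℚ) : ℚ_[p]) *
      ((Ideal.absNorm (WeierstrassCurve.denominatorIdeal H x₄) : ℚ) : ℚ_[p]) =
        ((Ideal.absNorm (WeierstrassCurve.denominatorIdeal H x₁) : ℚ) : ℚ_[p]) ^ 2 *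
          ((Ideal.absNorm (WeierstrassCurve.denominatorIdeal H x₂) : ℚ) : ℚ_[p]) ^ 2 *
          ((Algebra.norm ℚ (x₁ - x₂) : ℚ) : ℚ_[p]) ^ 2 := by
    have := congrArg (fun q : ℚ => (q : ℚ_[p])) hden
    push_cast at this ⊢
    exact this
  have hlogd : padicLog p ((Ideal.absNorm (WeierstrassCurve.denominatorIdeal H x₃) : ℚ) : ℚ_[p]) +
      padicLog p ((Ideal.absNorm (WeierstrassCurve.denominatorIdeal H x₄) : ℚ) : ℚ_[p]) =
        2 * padicLog p ((Ideal.absNorm (WeierstrassCurve.denominatorIdeal H x₁) : ℚ) : ℚ_[p]) +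
          2 * padicLog p ((Ideal.absNorm (WeierstrassCurve.denominatorIdeal H x₂) : ℚ) : ℚ_[p]) +
          2 * padicLog p ((Algebra.norm ℚ (x₁ - x₂) : ℚ) : ℚ_[p]) := by
    rw [← hmulp (hN0 x₃) (hN0 x₄), hdenp,
      hmulp (mul_ne_zero (pow_ne_zero 2 (hN0 x₁)) (pow_ne_zero 2 (hN0 x₂))) (pow_ne_zero 2 hδ),
      hmulp (pow_ne_zero 2 (hN0 x₁)) (pow_ne_zero 2 (hN0 x₂)), padicLog_sq (hN0 x₁),
      padicLog_sq (hN0 x₂), padicLog_sq hδ]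
  -- the `p`-part, read in `ℂ_p`
  obtain ⟨Log, -, hmul, hlog, hLp⟩ := PadicComplex.exists_iwasawaLog (p := p)
  set ι := algebraMap ℚ_[p] ℂ_[p] with hι
  set S := W.sigmaSqNormLog p H with hSdef
  set T : ℂ_[p] → ℂ_[p] := fun t => Log (padicAlgEval ℂ_[p] (W.baseChange ℚ_[p]).padicSigmaSq t)
    with hT
  -- embedding-side facts for the four points
  have hf₁ := fun σ => emb_facts_of_one_lt_norm (W := W) h₁ σ (hσ₁ σ)
  have hf₂ := fun σ => emb_facts_of_one_lt_norm (W := W) h₂ σ (hσ₂ σ)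
  have hf₃ := fun σ => emb_facts_of_one_lt_norm (W := W) h₃ σ (hσ₃ σ)
  have hf₄ := fun σ => emb_facts_of_one_lt_norm (W := W) h₄ σ (hσ₄ σ)
  -- `ι(S zᵢ) = Σ_σ T(σ zᵢ)`
  haveI : Nonempty (H →ₐ[ℚ] ℂ_[p]) := by
    have : 0 < Fintype.card (H →ₐ[ℚ] ℂ_[p]) := by
      rw [AlgHom.card ℚ H ℂ_[p]]; exact Module.finrank_pos
    exact Fintype.card_pos_iff.mp this
  obtain ⟨σ₀⟩ := (inferInstance : Nonempty (H →ₐ[ℚ] ℂ_[p]))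
  have hι₁ : ι (S (-x₁ / y₁)) = ∑ σ : H →ₐ[ℚ] ℂ_[p], T (σ (-x₁ / y₁)) :=
    algebraMap_sigmaSqNormLog_eq_sum_embeddings hmul hlog hLp (hf₁ σ₀).1 fun σ => (hf₁ σ).2.2.1
  have hι₂ : ι (S (-x₂ / y₂)) = ∑ σ : H →ₐ[ℚ] ℂ_[p], T (σ (-x₂ / y₂)) :=
    algebraMap_sigmaSqNormLog_eq_sum_embeddings hmul hlog hLp (hf₂ σ₀).1 fun σ => (hf₂ σ).2.2.1
  have hι₃ : ι (S (-x₃ / y₃)) = ∑ σ : H →ₐ[ℚ] ℂ_[p], T (σ (-x₃ / y₃)) :=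
    algebraMap_sigmaSqNormLog_eq_sum_embeddings hmul hlog hLp (hf₃ σ₀).1 fun σ => (hf₃ σ).2.2.1
  have hι₄ : ι (S (-x₄ / y₄)) = ∑ σ : H →ₐ[ℚ] ℂ_[p], T (σ (-x₄ / y₄)) :=
    algebraMap_sigmaSqNormLog_eq_sum_embeddings hmul hlog hLp (hf₄ σ₀).1 fun σ => (hf₄ σ).2.2.1
  -- the squared theta relation at every embedding, logarithmic form
  have hθ : ∀ σ : H →ₐ[ℚ] ℂ_[p],
      T (σ (-x₃ / y₃)) + T (σ (-x₄ / y₄)) =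
        2 * Log (σ (x₁ - x₂)) + 2 * T (σ (-x₁ / y₁)) + 2 * T (σ (-x₂ / y₂)) := by
    intro σ
    obtain ⟨-, hz₁, -, hz₁0⟩ := hf₁ σ
    obtain ⟨-, hz₂, -, hz₂0⟩ := hf₂ σ
    obtain ⟨-, hz₃, -, -⟩ := hf₃ σ
    obtain ⟨-, hz₄, -, -⟩ := hf₄ σ
    have hx₁n := hσ₁ σ
    have hx₂n := hσ₂ σ
    have key := W.padicAlgEval_padicSigmaSq_theta_ringHom p hpair H (σ : H →+* ℂ_[p]) h₁ h₂ h₃ h₄ hS hD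
      hx₁n hx₂n hx
    have hS₁ := W.padicAlgEval_padicSigmaSq_ringHom_ne_zero p H (σ : H →+* ℂ_[p]) h₁ hx₁n
    have hS₂ := W.padicAlgEval_padicSigmaSq_ringHom_ne_zero p H (σ : H →+* ℂ_[p]) h₂ hx₂n
    have hS₃ := W.padicAlgEval_padicSigmaSq_ringHom_ne_zero p H (σ : H →+* ℂ_[p]) h₃ (hσ₃ σ)
    have hS₄ := W.padicAlgEval_padicSigmaSq_ringHom_ne_zero p H (σ : H →+* ℂ_[p]) h₄ (hσ₄ σ)
    have hsq : ((σ : H →+* ℂ_[p]) x₂ - (σ : H →+* ℂ_[p]) x₁) ^ 2 = (σ (x₁ - x₂)) ^ 2 := by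
      rw [map_sub]; change (σ x₂ - σ x₁) ^ 2 = (σ x₁ - σ x₂) ^ 2; ring
    have hδ0 : σ (x₁ - x₂) ≠ 0 := (map_ne_zero σ).mpr (sub_ne_zero.mpr hx)
    simp only [hT, hz₁, hz₂, hz₃, hz₄]
    change Log (padicAlgEval ℂ_[p] (W.baseChange ℚ_[p]).padicSigmaSq (-(σ : H →+* ℂ_[p]) x₃ / (σ : H →+* ℂ_[p]) y₃)) +
        Log (padicAlgEval ℂ_[p] (W.baseChange ℚ_[p]).padicSigmaSq (-(σ : H →+* ℂ_[p]) x₄ / (σ : H →+* ℂ_[p]) y₄)) =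
      2 * Log (σ (x₁ - x₂)) +
        2 * Log (padicAlgEval ℂ_[p] (W.baseChange ℚ_[p]).padicSigmaSq (-(σ : H →+* ℂ_[p]) x₁ / (σ : H →+* ℂ_[p]) y₁)) +
        2 * Log (padicAlgEval ℂ_[p] (W.baseChange ℚ_[p]).padicSigmaSq (-(σ : H →+* ℂ_[p]) x₂ / (σ : H →+* ℂ_[p]) y₂))
    rw [← hmul _ _ hS₃ hS₄, key, hsq, hmul _ _ (mul_ne_zero (pow_ne_zero 2 hδ0) (pow_ne_zero 2 hS₁))
      (pow_ne_zero 2 hS₂), hmul _ _ (pow_ne_zero 2 hδ0) (pow_ne_zero 2 hS₁), logFun_pow hmul hδ0,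
      logFun_pow hmul hS₁, logFun_pow hmul hS₂]
    push_cast
    ring
  -- `Σ_σ Log σ(x₁ − x₂) = ι log_p N(x₁ − x₂)`
  have hδsum : ∑ σ : H →ₐ[ℚ] ℂ_[p], Log (σ (x₁ - x₂)) =
      ι (padicLog p ((Algebra.norm ℚ (x₁ - x₂) : ℚ) : ℚ_[p])) := by
    have hne : Algebra.norm ℚ (x₁ - x₂) ≠ 0 := Algebra.norm_ne_zero_iff.mpr (sub_ne_zero.mpr hx)
    rw [← logFun_prod hmul _ fun σ _ => (map_ne_zero σ).mpr (sub_ne_zero.mpr hx),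
      ← Algebra.norm_eq_prod_embeddings ℚ ℂ_[p] (x₁ - x₂),
      show algebraMap ℚ ℂ_[p] (Algebra.norm ℚ (x₁ - x₂)) = ι ((Algebra.norm ℚ (x₁ - x₂) : ℚ) : ℚ_[p]) by
        rw [eq_ratCast, hι, map_ratCast],
      log_algebraMap_padic hmul hlog hLp (by exact_mod_cast hne)]
  -- the `p`-part identity in `ℚ_p` (by injectivity of `ι`)
  have hsig : S (-x₃ / y₃) + S (-x₄ / y₄) =
      2 * S (-x₁ / y₁) + 2 * S (-x₂ / y₂) + 2 * padicLog p ((Algebra.norm ℚ (x₁ - x₂) : ℚ) : ℚ_[p]) := by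
    apply (algebraMap ℚ_[p] ℂ_[p]).injective
    rw [map_add, ← hι, hι₃, hι₄, ← Finset.sum_add_distrib, Finset.sum_congr rfl fun σ _ => hθ σ,
      Finset.sum_add_distrib, Finset.sum_add_distrib, ← Finset.mul_sum, ← Finset.mul_sum, ← Finset.mul_sum,
      hδsum, ← hι₁, ← hι₂]
    simp only [map_add, map_mul, map_ofNat]
    ring
  -- conclusion
  simp only [WeierstrassCurve.canonicalPAdicHeightCyc_some]
  rw [← hSdef] at *
  linear_combination hlogd - hsig

end Literature.NumberTheory.EllipticCurves

end
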